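import Summits.AtomisticToContinuum.Crystallization.Theorems.PalmUnimodularRigidityLayeredLawsSelectHcpDefs
import Mathlib.Algebra.BigOperators.Finprod

/-!
# Route `PalmUnimodularRigidity`, crux `LayeredLawsSelectHcp` (stmt-AtomisticToContinuum-9226):
# vocabulary of the rigidity CERTIFICATE (line `mtp-prestress-split-ergodic-frame`, lead c2 reshape)

The rigidity core `stub_hcpTubeRigidity` (law-level strict local minimality of relaxed Lennard-Jones hcp in the 1 % tube) is attacked
through a FRAME-FREE REAL-SPACE CERTIFICATE (`Cruxes/LayeredLawsSelectHcp/LeadC2Architecture.md`): a POINTWISE inequality at the root of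
every rooted hcp-charted tube configuration, `hNear + φfar − e₀ − κ·starDefect + Σ correctors ≥ 0`, in which the law enters only through
CORRECTORS whose mean vanishes under every point-stationary law (the Mecke identity: `tube_weightedTransport`, `tube_meckeIntegral`,
landed).  This reviewed module fixes the objects the reshaped skeleton quantifies over:

* `atoms μ`, `IsRootedChart S X`, `rootedCharts μ` — rooted LABELLED charts `X : ℤ³ → ℝ³` (`X 0 = 0`, onto the carrier, ideal unit struts
  ↔ bonds `0 < dist ≤ 28/25`; they exist for hcp-charted carriers, `tube_exists_rootedChart`, landed);
* `labelShift c`, `reRoot X c` — the index form of the ideal-hcp automorphism moving the root to the label `c` (translation on even layers,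
  `u ↦ c − u` on odd ones: `hcpSite (labelShift c u) = hcpSite c ± hcpSite u`) and the chart re-rooted at `X c` through it;
* `chartAvg φ μ = (1/12) ∑ᶠ X ∈ rootedCharts μ, φ X` — chart-averaged local functionals (an hcp-charted carrier has exactly twelve rooted
  charts, so this is the common value of a label-symmetric `φ`);
* `CorrDatum`, `corrector d μ = d.coef · ∑ᶠ X ∈ rootedCharts μ, (d.φ (reRoot X d.shift) − d.φ X)` — the DIRECTED ORBIT-SUM CORRECTOR of a
  datum (coefficient, local functional, shift label); `IsLocalFunctional φ` / `CorrDatum.Admissible` — `φ` reads finitely many labels through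
  a measurable bounded function (the hypotheses under which the corrector is integrable with zero mean);
* `nearLabels` (the 56 labels of the graph ball of radius 2: `12·‖hcpSite 1 √(2/3) u‖² ∈ {12,24,32,36,44,48}`), `nearEnergy X =
  ½ ∑_{u ∈ nearLabels} V_LJ ‖X u‖`, `hNear = chartAvg nearEnergy` — the near part of the root energy.

All definitions carry parameters or are finite data (route-internal bookkeeping, not literature facts); everything is `[folklore]`; the
anchor `labelShift_zero` is a registered sub-goal of stmt-AtomisticToContinuum-9226; nothing here closes an item.
-/

noncomputable section

namespace Summit.AtomisticToContinuum.Crystallization.Theorems.PalmUnimodularRigidity.LayeredLawsSelectHcp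

open MeasureTheory Set
open Literature.MathematicalPhysics.StatisticalMechanics Literature.Geometry.DiscreteGeometry

/-! ## Rooted labelled charts -/

/-- The atoms (carrier) of a configuration measure: the points of positive mass. [folklore] -/
def atoms (μ : Measure (EuclideanSpace ℝ (Fin 3))) : Set (EuclideanSpace ℝ (Fin 3)) :=
  {y | μ {y} ≠ 0}

/-- **Rooted labelled chart** of a point set `S`: a labelling `X : ℤ³ → ℝ³` of `S` by the ideal hcp indices with the root at the
origin, onto `S`, under which the ideal unit struts are exactly the bonds of `S` (distance in `(0, 28/25]`). [folklore] -/
def IsRootedChart (S : Set (EuclideanSpace ℝ (Fin 3))) (X : ℤ × ℤ × ℤ → EuclideanSpace ℝ (Fin 3)) : Prop :=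
  X 0 = 0 ∧ (∀ u, X u ∈ S) ∧ (∀ y ∈ S, ∃ u, X u = y) ∧
    ∀ u w, dist (hcpSite 1 (Real.sqrt (2 / 3)) u) (hcpSite 1 (Real.sqrt (2 / 3)) w) = 1 ↔
      (0 < dist (X u) (X w) ∧ dist (X u) (X w) ≤ 28 / 25)

/-- The rooted labelled charts of a configuration measure (of its carrier). [folklore] -/
def rootedCharts (μ : Measure (EuclideanSpace ℝ (Fin 3))) : Set (ℤ × ℤ × ℤ → EuclideanSpace ℝ (Fin 3)) :=
  {X | IsRootedChart (atoms μ) X}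

/-- **Label transport**: the index form of the ideal-hcp automorphism moving the root to the label `c` — translation by `c` when `c`
lies in an even layer (same sublattice), the point inversion `u ↦ c − u` when `c` lies in an odd layer (`hcp − b = −hcp`); in both
cases `hcpSite a h (labelShift c u) = hcpSite a h c ± hcpSite a h u`. [folklore] -/
def labelShift (c u : ℤ × ℤ × ℤ) : ℤ × ℤ × ℤ :=
  if Even c.1 then c + u else c - u

/-- **Re-rooted chart**: the labelled configuration seen from the atom `X c`, read through the transported labels. [folklore] -/
def reRoot (X : ℤ × ℤ × ℤ → EuclideanSpace ℝ (Fin 3)) (c : ℤ × ℤ × ℤ) : ℤ × ℤ × ℤ → EuclideanSpace ℝ (Fin 3) :=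
  fun u => X (labelShift c u) - X c

/-- **Chart average** of a functional of labelled configurations: `(1/12) ∑ᶠ_{X ∈ rootedCharts μ} φ X` (an hcp-charted carrier has
exactly twelve rooted charts; for a label-symmetric `φ` this is its common value; junk `0` when there is no finite chart set). [folklore] -/
def chartAvg (φ : (ℤ × ℤ × ℤ → EuclideanSpace ℝ (Fin 3)) → ℝ) (μ : Measure (EuclideanSpace ℝ (Fin 3))) : ℝ :=
  (1 / 12) * ∑ᶠ X ∈ rootedCharts μ, φ X

/-! ## Correctors -/

/-- A corrector datum: a coefficient, a functional of labelled configurations, and a shift label. [folklore] -/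
structure CorrDatum where
  /-- the coefficient -/
  coef : ℝ
  /-- the local functional of the labelled configuration -/
  φ : (ℤ × ℤ × ℤ → EuclideanSpace ℝ (Fin 3)) → ℝ
  /-- the shift label -/
  shift : ℤ × ℤ × ℤ

/-- **The directed orbit-sum corrector** of a datum: `coef · ∑ᶠ_{X ∈ rootedCharts μ} (φ (reRoot X shift) − φ X)` — "the functional read
from the atom labelled `shift`, summed over all twelve charts, minus the same at the root".  Its mean vanishes under every point-stationary
law carried by hcp-charted configurations (Mecke identity + the bijection `(y, Ψ) ↦ Ψ ∘ τ_c` of charts). [folklore] -/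
def corrector (d : CorrDatum) (μ : Measure (EuclideanSpace ℝ (Fin 3))) : ℝ :=
  d.coef * ∑ᶠ X ∈ rootedCharts μ, (d.φ (reRoot X d.shift) - d.φ X)

/-- **Local functional**: `φ` reads the labelled configuration only at finitely many labels, through a measurable function, and is
bounded (certificate functionals are clipped outside the tube, where the pointwise inequality is not claimed). [folklore] -/
def IsLocalFunctional (φ : (ℤ × ℤ × ℤ → EuclideanSpace ℝ (Fin 3)) → ℝ) : Prop :=
  ∃ (L : Finset (ℤ × ℤ × ℤ)) (ψ : (↥L → EuclideanSpace ℝ (Fin 3)) → ℝ) (C : ℝ),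
    Measurable ψ ∧ (∀ X, φ X = ψ (fun u => X u)) ∧ ∀ X, |φ X| ≤ C

/-- Admissible corrector data: the functional is local. [folklore] -/
def CorrDatum.Admissible (d : CorrDatum) : Prop :=
  IsLocalFunctional d.φ

/-! ## The near part of the root energy -/

/-- **The 56 near labels**: the graph ball of radius `2` around the root of the ideal hcp, minus the root (`12·‖hcpSite 1 √(2/3) u‖² ∈
{12, 24, 32, 36, 44, 48}`: the twelve struts, then the shells `√2, √(8/3), √3, √(11/3), 2`). [folklore] -/
def nearLabels : Finset (ℤ × ℤ × ℤ) :=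
  {(-2, -1, 0), (-2, -1, 1), (-2, 0, -1), (-2, 0, 0), (-2, 0, 1), (-2, 1, -1), (-2, 1, 0), (-1, -2, 0), (-1, -2, 1),
   (-1, -1, -1), (-1, -1, 0), (-1, -1, 1), (-1, 0, -2), (-1, 0, -1), (-1, 0, 0), (-1, 0, 1), (-1, 1, -2), (-1, 1, -1),
   (-1, 1, 0), (0, -2, 0), (0, -2, 1), (0, -2, 2), (0, -1, -1), (0, -1, 0), (0, -1, 1), (0, -1, 2), (0, 0, -2), (0, 0, -1),
   (0, 0, 1), (0, 0, 2), (0, 1, -2), (0, 1, -1), (0, 1, 0), (0, 1, 1), (0, 2, -2), (0, 2, -1), (0, 2, 0), (1, -2, 0),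
   (1, -2, 1), (1, -1, -1), (1, -1, 0), (1, -1, 1), (1, 0, -2), (1, 0, -1), (1, 0, 0), (1, 0, 1), (1, 1, -2), (1, 1, -1),
   (1, 1, 0), (2, -1, 0), (2, -1, 1), (2, 0, -1), (2, 0, 0), (2, 0, 1), (2, 1, -1), (2, 1, 0)}

/-- The near energy of a labelled configuration: `½ ∑_{u ∈ nearLabels} V_LJ ‖X u‖`. [folklore] -/
def nearEnergy (X : ℤ × ℤ × ℤ → EuclideanSpace ℝ (Fin 3)) : ℝ :=
  (1 / 2) * ∑ u ∈ nearLabels, lennardJones ‖X u‖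

/-- **The near part of the root energy** of a configuration measure (chart-averaged; label-symmetric, so the common value). [folklore] -/
def hNear (μ : Measure (EuclideanSpace ℝ (Fin 3))) : ℝ :=
  chartAvg nearEnergy μ

/-! ## Elementary read-backs -/

/-- Anchor (registered sub-goal of stmt-AtomisticToContinuum-9226): transporting the root label gives the shift label itself.
[folklore] -/
theorem labelShift_zero : ∀ c : ℤ × ℤ × ℤ, labelShift c 0 = c := by
  intro c
  unfold labelShift
  split_ifs <;> simp

/-- Re-rooting at the root label is the identity (`labelShift 0 = id`, `X 0` subtracted). [folklore] -/
theorem reRoot_zero (X : ℤ × ℤ × ℤ → EuclideanSpace ℝ (Fin 3)) (hX : X 0 = 0) : reRoot X 0 = X := by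
  funext u
  simp [reRoot, labelShift, hX]

/-- A corrector with coefficient `0` vanishes. [folklore] -/
theorem corrector_zero_coef (φ : (ℤ × ℤ × ℤ → EuclideanSpace ℝ (Fin 3)) → ℝ) (c : ℤ × ℤ × ℤ)
    (μ : Measure (EuclideanSpace ℝ (Fin 3))) : corrector ⟨0, φ, c⟩ μ = 0 := by
  simp [corrector]

end Summit.AtomisticToContinuum.Crystallization.Theorems.PalmUnimodularRigidity.LayeredLawsSelectHcp

end
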